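import Mathlib
import Summits.ResolutionOfSingularities.ResolutionOfSingularities.Theorems.WildQuotientsWildQuotientResolutionInitialFormInjective

/-!
# Peeling frame, PF-B: upper-set monomial ideals cut out by weights are stable under weight-raising substitutions

(crux stmt-ResolutionOfSingularities-15640 `WildQuotients.WildQuotientResolution`, post-V5 card O of
res-L1-w45c-idea-2 (O8 `𝔸⁴/(ℤ/4)`, O9), design memo `L/w45c/O8-Z4-DESIGN.md` §1/§5/§9 (stub-1);
SHARED-FRAME piece PF-B of res-L1-w45c-plan-1's RULING 2026-08-27T16:28:20Z. [OURS · L1 W4.5c] —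
generic commutative algebra, NOT a statement of any manuscript; replaces the role of no printed item.
Uses only Mathlib and the lower-bound bookkeeping `JordanFour.lb_*` of `…InitialFormInjective`.)

The frame ideals of the one-shot rungs (V4U `I₆`, V5 `I₁₂`, ℤ9 `I₂₈`, O8 `𝔍`) are MONOMIAL ideals of a
polynomial ring cut out by finitely many linear inequalities with non-negative coefficients:
`𝔟 = (yᵉ : d_l ≤ ⟨W_l, e⟩ for all l)`. Their stability under the group is always the same argument: the
substitution `φ = aeval g` RAISES every weight filtration (`g i` has only monomials of `W_l`-weight
`≥ W_l i`), hence maps `𝔟` into itself. This file proves that once: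

* `mem_span_monomial_weights_iff` — `f ∈ 𝔟` iff every monomial of `f` satisfies all the inequalities;
* `lb_aeval` — a weight-raising `aeval g` preserves lower weight bounds;
* `map_aeval_span_monomial_weights_le` — **`𝔟.map (aeval g) ≤ 𝔟`**;
* `map_map_le_of_comp_eq` — transport along any ring map `ι` intertwining `φ` with an endomorphism
  `σ` of the target (`σ ∘ ι = ι ∘ φ`): `(𝔟.map ι).map σ ≤ 𝔟.map ι` (how O8's `𝔍 = 𝔟_E · k[x]`, generated
  by monomials in the invariants `x₁, x₀, M`, inherits `σ`-stability from the three exponent moves).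
-/

-- single-problem summit: the doubled namespace component `ResolutionOfSingularities` is forced
set_option linter.dupNamespace false

noncomputable section

open MvPolynomial

namespace Summit.ResolutionOfSingularities.ResolutionOfSingularities.Theorems.WildQuotientResolution.PeelingFrame

variable {R : Type*} [CommRing R] {σ L : Type*}

/-- Weights are monotone: `e' ≤ e → ⟨w, e'⟩ ≤ ⟨w, e⟩`. [folklore] -/
theorem weight_mono (w : σ → ℕ) {e e' : σ →₀ ℕ} (h : e' ≤ e) :
    Finsupp.weight w e' ≤ Finsupp.weight w e := by
  have : e' + (e - e') = e := add_tsub_cancel_of_le h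
  rw [← this, map_add]
  exact Nat.le_add_right _ _

/-- **Membership in a weight-cut monomial ideal**: `f ∈ (yᵉ : ∀ l, d_l ≤ ⟨W_l, e⟩)` iff every monomial of
`f` satisfies all the inequalities (the exponent set is an upper set). [folklore] -/
theorem mem_span_monomial_weights_iff (W : L → σ → ℕ) (d : L → ℕ) (f : MvPolynomial σ R) :
    f ∈ Ideal.span ((fun e => monomial e (1 : R)) '' {e | ∀ l, d l ≤ Finsupp.weight (W l) e}) ↔
      ∀ e, coeff e f ≠ 0 → ∀ l, d l ≤ Finsupp.weight (W l) e := by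
  rw [mem_ideal_span_monomial_image]
  constructor
  · intro h e he l
    obtain ⟨e', he', hle⟩ := h e (mem_support_iff.mpr he)
    exact (he' l).trans (weight_mono (W l) hle)
  · intro h e he
    exact ⟨e, fun l => h e (mem_support_iff.mp he) l, le_rfl⟩

/-- A product `∏_{i ∈ s} (g i)^(e i)` of weight-raising elements has only monomials of weight
`≥ Σ_{i ∈ s} e i · w i`. [folklore] -/
theorem lb_prod_pow (w : σ → ℕ) {τ : Type*} (g : τ → MvPolynomial σ R) (v : τ → ℕ)
    (hg : ∀ i, ∀ e, coeff e (g i) ≠ 0 → v i ≤ Finsupp.weight w e) (s : Finset τ) (n : τ → ℕ) :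
    ∀ e, coeff e (∏ i ∈ s, g i ^ n i) ≠ 0 → (∑ i ∈ s, n i * v i) ≤ Finsupp.weight w e := by
  classical
  induction s using Finset.induction_on with
  | empty =>
    intro e _
    simp
  | insert i s hi ih =>
    rw [Finset.prod_insert hi, Finset.sum_insert hi]
    exact JordanFour.lb_mul w (JordanFour.lb_pow w (hg i) (n i)) ih

/-- **A weight-raising substitution preserves lower weight bounds**: if every `g i` has only monomials of
`w`-weight `≥ w i`, and `f` has only monomials of weight `≥ d`, then so does `aeval g f`. [folklore] -/
theorem lb_aeval (w : σ → ℕ) (g : σ → MvPolynomial σ R)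
    (hg : ∀ i, ∀ e, coeff e (g i) ≠ 0 → w i ≤ Finsupp.weight w e)
    {d : ℕ} {f : MvPolynomial σ R} (hf : ∀ e, coeff e f ≠ 0 → d ≤ Finsupp.weight w e) :
    ∀ e, coeff e (aeval g f) ≠ 0 → d ≤ Finsupp.weight w e := by
  classical
  rw [f.as_sum, map_sum]
  refine Finset.sum_induction _ (fun h : MvPolynomial σ R => ∀ e, coeff e h ≠ 0 → d ≤ Finsupp.weight w e)
    (fun x y hx hy => JordanFour.lb_add w hx hy) (fun e he => absurd (coeff_zero e) he) ?_
  intro e₀ he₀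
  have hd : d ≤ Finsupp.weight w e₀ := hf e₀ (mem_support_iff.mp he₀)
  rw [aeval_monomial, MvPolynomial.algebraMap_eq, Finsupp.prod]
  refine JordanFour.lb_mono w ?_ (JordanFour.lb_C_mul w (coeff e₀ f) (lb_prod_pow w g w hg e₀.support e₀))
  rw [Finsupp.weight_apply, Finsupp.sum] at hd
  simpa [smul_eq_mul] using hd

/-- **PF-B: weight-cut monomial ideals are stable under weight-raising substitutions.** If for every `l`
and every variable `i` the polynomial `g i` has only monomials of `W_l`-weight `≥ W_l i`, then
`aeval g` maps `𝔟 = (yᵉ : ∀ l, d_l ≤ ⟨W_l, e⟩)` into itself. (O8: the moves `x₁ → x₀`, `M → x₀x₁`,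
`M → x₁²` raise all five weights; ℤ9: `x_b ↦ x_b + x_a`, `x_c ↦ x_c + x_b` raise the (7,4,1)-weight.)
[OURS · L1 W4.5c] -/
theorem map_aeval_span_monomial_weights_le (W : L → σ → ℕ) (d : L → ℕ) (g : σ → MvPolynomial σ R)
    (hg : ∀ l i, ∀ e, coeff e (g i) ≠ 0 → W l i ≤ Finsupp.weight (W l) e) :
    (Ideal.span ((fun e => monomial e (1 : R)) '' {e | ∀ l, d l ≤ Finsupp.weight (W l) e})).map
        (aeval g) ≤
      Ideal.span ((fun e => monomial e (1 : R)) '' {e | ∀ l, d l ≤ Finsupp.weight (W l) e}) := by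
  classical
  rw [Ideal.map_le_iff_le_comap, Ideal.span_le]
  rintro _ ⟨e, he, rfl⟩
  rw [SetLike.mem_coe, Ideal.mem_comap, mem_span_monomial_weights_iff]
  intro e' he' l
  refine lb_aeval (W l) g (hg l) (f := monomial e (1 : R)) (fun e'' h => ?_) e' he'
  rw [coeff_monomial] at h
  split_ifs at h with hee
  · rw [← hee]; exact he l
  · exact absurd rfl h

/-- The same for an algebra ENDOMORPHISM given by its values: `φ = aeval (φ ∘ X)`. [folklore] -/
theorem map_span_monomial_weights_le (W : L → σ → ℕ) (d : L → ℕ)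
    (φ : MvPolynomial σ R →ₐ[R] MvPolynomial σ R)
    (hφ : ∀ l i, ∀ e, coeff e (φ (X i)) ≠ 0 → W l i ≤ Finsupp.weight (W l) e) :
    (Ideal.span ((fun e => monomial e (1 : R)) '' {e | ∀ l, d l ≤ Finsupp.weight (W l) e})).map φ ≤
      Ideal.span ((fun e => monomial e (1 : R)) '' {e | ∀ l, d l ≤ Finsupp.weight (W l) e}) := by
  have hφ' : φ = aeval (fun i => φ (X i)) := by
    refine MvPolynomial.algHom_ext fun i => ?_
    rw [aeval_X]
  rw [hφ']
  exact map_aeval_span_monomial_weights_le W d _ hφ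

/-- **Transport of stability along an intertwining map.** For ring maps `ι : A → S`, `φ : A → A`,
`τ : S → S` with `τ ∘ ι = ι ∘ φ` and an ideal `𝔟` of `A` with `𝔟.map φ ≤ 𝔟`, the extended ideal
`𝔟 S = 𝔟.map ι` satisfies `(𝔟 S).map τ ≤ 𝔟 S`. (O8: `A = k[y₁,y₂,y₃] → k[x]`, `y ↦ (x₁, x₀, M)`,
`τ = σ = J₄`.) [folklore] -/
theorem map_map_le_of_comp_eq {A S : Type*} [CommRing A] [CommRing S] (ι : A →+* S) (φ : A →+* A)
    (τ : S →+* S) (hcomm : τ.comp ι = ι.comp φ) (𝔟 : Ideal A) (h𝔟 : 𝔟.map φ ≤ 𝔟) :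
    (𝔟.map ι).map τ ≤ 𝔟.map ι := by
  rw [Ideal.map_map, hcomm, ← Ideal.map_map]
  exact Ideal.map_mono h𝔟

/-- Iteration: if `J.map τ ≤ J` then `J.map (τ ^ j) ≤ J` for every `j` (so a `σ`-stable ideal is
stable under the whole cyclic group `⟨σ⟩` of a finite-order `σ`). [folklore] -/
theorem map_pow_le_of_map_le {S : Type*} [CommRing S] (τ : S →+* S) (J : Ideal S)
    (hle : J.map τ ≤ J) : ∀ j : ℕ, J.map (τ ^ j) ≤ J
  | 0 => by rw [pow_zero, RingHom.one_def, Ideal.map_id]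
  | j + 1 => by
    rw [pow_succ', RingHom.mul_def, ← Ideal.map_map]
    exact (Ideal.map_mono (map_pow_le_of_map_le τ J hle j)).trans hle

end Summit.ResolutionOfSingularities.ResolutionOfSingularities.Theorems.WildQuotientResolution.PeelingFrame

end
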